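import Summits.AtomisticToContinuum.Crystallization.Theorems.HolmgrenBoyleLindGroundStatesChargeFLCEquilibriumOfChargePeriodic

/-!
# Crux `HolmgrenBoyleLind.GroundStatesChargeFLCEquilibrium` (stmt-AtomisticToContinuum-6076) and the
# periodic hinge `GroundStatesChargePeriodic` (stmt-AtomisticToContinuum-2911): equivalence modulo the
# route's headline theorem `FLCEquilibriumPeriodic` (stmt-AtomisticToContinuum-6079)

* `groundStatesChargePeriodic_of_groundStatesChargeFLCEquilibrium` — LIM and `FLCEquilibriumPeriodic`
  (every FLC Delone Lennard-Jones equilibrium of `ℝ³` is periodic, = UC ∧ HSR of the route) give the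
  hinge `GroundStatesChargePeriodic`: the charged FLC equilibrium `Λ` is the point set of a periodic
  configuration, and the charging clause is the hinge's clause verbatim (the step of the route's
  deciding theorem `closes`, isolated).
* `groundStatesChargeFLCEquilibrium_iff_groundStatesChargePeriodic` — with the landed converse
  `groundStatesChargeFLCEquilibrium_of_groundStatesChargePeriodic` (p145894: a charged periodic
  configuration is a `δ`-separated, relatively dense FLC set in exact force balance by finite-`N`
  criticality): under `FLCEquilibriumPeriodic` the crux and the hinge are EQUIVALENT.

Plan consequence recorded for the planners (D-0014): inside route `HolmgrenBoyleLind` the crux LIM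
carries no strength beyond the shared hinge 2911 once the route's own `FLCEquilibriumPeriodic`
holds, and no less without it; its only FLC-specific entry point is
`groundStatesChargeFLCEquilibrium_of_cohesive_of_frequentlyFLC` (p153723). Pure logic on route
statements; nothing here closes an item. [folklore]
-/

namespace Summit.AtomisticToContinuum.Crystallization.Theorems.HolmgrenBoyleLindGroundStatesChargeFLCEquilibrium

open Summit.AtomisticToContinuum.Crystallization.Theses.HolmgrenBoyleLind

/-- **LIM ∧ FLCEquilibriumPeriodic ⇒ the periodic hinge.** If every sequence of Lennard-Jones ground
states charges ONE FLC Delone set in exact force balance (the crux) and every FLC Delone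
Lennard-Jones equilibrium of `ℝ³` is the point set of a periodic configuration (item 6079), then every
sequence of ground states charges ONE periodic configuration (item 2911): the charging clauses agree
verbatim once `Λ = Q.points`. [folklore] -/
theorem groundStatesChargePeriodic_of_groundStatesChargeFLCEquilibrium : Summit.AtomisticToContinuum.Crystallization.Theses.HolmgrenBoyleLind.GroundStatesChargeFLCEquilibrium → Summit.AtomisticToContinuum.Crystallization.Theses.HolmgrenBoyleLind.FLCEquilibriumPeriodic → Summit.AtomisticToContinuum.Crystallization.Theses.HolmgrenBoyleLind.GroundStatesChargePeriodic := by
  intro hLIM hPer x hx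
  obtain ⟨Λ, δ, r, hδ, hr, hsep, hden, hFLC, hbal, hch⟩ := hLIM x hx
  obtain ⟨Q, hQ⟩ := hPer Λ δ r hδ hr hsep hden hFLC hbal
  subst hQ
  exact ⟨Q, hch⟩

/-- **Under `FLCEquilibriumPeriodic` the crux and the periodic hinge are equivalent**
(`groundStatesChargePeriodic_of_groundStatesChargeFLCEquilibrium` and the landed converse
`groundStatesChargeFLCEquilibrium_of_groundStatesChargePeriodic`, p145894). [folklore] -/
theorem groundStatesChargeFLCEquilibrium_iff_groundStatesChargePeriodic
    (hPer : FLCEquilibriumPeriodic) :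
    GroundStatesChargeFLCEquilibrium ↔ GroundStatesChargePeriodic :=
  ⟨fun hLIM => groundStatesChargePeriodic_of_groundStatesChargeFLCEquilibrium hLIM hPer,
    groundStatesChargeFLCEquilibrium_of_groundStatesChargePeriodic⟩

end Summit.AtomisticToContinuum.Crystallization.Theorems.HolmgrenBoyleLindGroundStatesChargeFLCEquilibrium
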